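import Literature.MathematicalPhysics.QuantumFieldTheory.BalabanImbrieJaffe1984to88.BIJ85GaugeFunction5113
import Literature.MathematicalPhysics.QuantumFieldTheory.BalabanImbrieJaffe1984to88.BIJ85AxialPropagator411
import Literature.MathematicalPhysics.QuantumFieldTheory.Balaban1983to89.B5Eq120IterProof

/-!
# `BalabanImbrieJaffe1984to88.BIJ85Eq5113Proof` — T. Bałaban, J. Imbrie, A. Jaffe, *Renormalization of the Higgs model: minimizers,
propagators and the stability of mean field theory*, Commun. Math. Phys. **97** (1985) 299–329 [BalabanImbrieJaffe1985]: Sect. 5.1,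
proof of Proposition 5.1.1, pp. 314–315 — **(5.1.10), (5.1.11), (5.1.12) PROVED; (5.1.13) PROVED as the UNIQUE solution of the linear
system of (5.1.9) (with existence); (5.1.14)–(5.1.15) PROVED in Bochner-integral form** (file 2 of 2; objects in `…BIJ85GaugeFunction5113`)

statement-level skeleton of published theorems with citation tags; proofs where landed; nothing here is a claim about the Yang–Mills mass gap

PDF held: `paper:balaban1985-cmp97-bij-higgs-minimizers` (journal page = PDF page + 298); pp. 314–315 [PDF 16–17] read as images
(`run/shared/lean/pub/lit-balaban/lit-balaban-p08/renders/bij85-p016.png`, `…p017.png`).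

CITATION HEADER (lean-in-tree rule).  Phase-2 PROOF file of the lit-balaban typed skeleton (HOME `run/shared/lean/pub/lit-balaban/`), SKELETON
row **`C1.Eq5.1.5-5.1.15`** (proof of Prop. 5.1.1), seat p08 gen 2 (unit `lit-balaban-p08-g2`).  WHAT IS REPRODUCED (carriers and conventions as
in file 1: lattice factor `c` of `∂` explicit, printed `(L^jη)^{−1}` = `c/L^j`, printed `L^jη = L^{j−k}` = `L^j/c`; `x_{j+1} ∈ T^{(j+1)}` read in
`T^{(j)}` as `emb x_{j+1}`, `x′ ∈ B(x_{j+1})` as `Site.blockSite x_{j+1} r`; standing range `k ≤ m + K` of `Setup.Params`):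
* §1c — *"λ = λ(A) is a linear function of A"* (p. 315): `lamOf_add`, `lamOf_smul`, `lamOf_sub` (with the linearity of the contour
  functionals, from `…BIJ85AxialPropagator411`'s `stairSum_add/smul`, `bondAvgIter_add/smul`);
* §2 — **(5.1.10)** (`eq5110`; bond form `eq5110_bond` = the first display of p. 315), **(5.1.11)** (`eq5111`), **(5.1.12)** (`eq5112`), each
  from ONE factor `δ_{Ax}(Q_j(A + ∂λ))` of `δ_{k,Ax}(A + ∂λ)`, via `Q_j∂ = ∂Q′_j` ([Balaban1984PropagatorsI] (1.20), tree
  `B5Eq120IterProof.bondAvgIter_grad`) and the telescoping of `∂` along `Γ` (`B5Eq120IterProof.stairSum_grad`);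
* §3 — the printed telescoping *"summing (5.1.12) from j = 0 to j = k − 1"* (`eq_pull_add_lamOf`: `λ = (Q′_kλ)(x_k) + λ_k(A)`) and **(5.1.13)**
  *"Using the δ function for Q′_kλ"*: every `λ` with `Q′_kλ = 0` and `δ_{k,Ax}(A + ∂λ)` equals `lamOf c k A` (`eq5113`, UNIQUENESS); conversely
  `lamOf c k A` satisfies both constraints (`siteAvgIter_lamOf`, `deltaAx_lamOf`, EXISTENCE — needed for *"we solve the system of linear
  equations"* to denote; not displayed in print), whence `existsUnique_gaugeFn`; and `Q_k(A + ∂λ(A)) = Q_kA` (the remark before (5.1.8));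
* §4 — **(5.1.14)** (`eq5114`) and its vanishing term (`eq5114_vanish`) for the expectation under ANY probability law `μ` of the real η-lattice
  bond fields with mean `H` (= `H_kB`), and **(5.1.15)/Prop. 5.1.1 in mean form** (`prop511_mean`): `∫(A + ∂λ(A))dμ − ∫A dμ = ∂λ(∫A dμ)`
  for every law with integrable identity — the content of *"the term … is linear in A − H_kB and hence its integral vanishes"*.
NOT REPRODUCED (the instance's, said again): the δ-function steps (5.1.5)–(5.1.9), i.e. that the left side IS the axial minimizer `H_{k,Ax}B`
of (4.1.3)/(5.1.5) and that `μ` IS the Landau-gauge law of (5.1.7) with mean `H_kB`; these involve the functional-integral definitions kept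
abstract on `…BIJ85Sect4Statements.GaugeRG`.  PRINT NOTE (HOME/GAPS.md G-C1-01): p. 315 line after (5.1.13) prints *"λ(A, x) = λ(H_kB, x) −
λ(A − H_kB, x)"*; linearity gives `+` (`lamOf_sub`/`lamOf_add`), and (5.1.14) itself is printed with the correct `+`.
-/

namespace Literature.MathematicalPhysics.QuantumFieldTheory.BalabanImbrieJaffe1984to88.BIJ85Eq5113Proof

open Literature.MathematicalPhysics.QuantumFieldTheory.Balaban1983to89
open LatticeFieldCalculus B5Eq120IterProof BIJ85AxialPropagator411 BIJ85GaugeFunction5113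

/-! ## §1c  Linearity of the contour functionals and of `λ(A)` (p. 315: *"λ = λ(A) is a linear function of A"*) -/

section Linearity

variable {P : Params} {j : ℕ} {V : Type*} [AddCommGroup V] [Module ℝ V]

/-- `Q_k` commutes with subtraction. [cite: Balaban1984PropagatorsI, (1.18) p.20] -/
theorem bondAvgIter_sub (k : ℕ) (A B : VecField P 0 V) : bondAvgIter k (A - B) = bondAvgIter k A - bondAvgIter k B := by
  rw [sub_eq_add_neg, bondAvgIter_add, ← neg_one_smul ℝ B, bondAvgIter_smul, neg_one_smul, ← sub_eq_add_neg]

omit [Module ℝ V] in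
/-- The axial gauge condition (3.4) is closed under subtraction. [cite: BalabanImbrieJaffe1985, (3.4) p.306] -/
theorem isAxial_sub {j : ℕ} {A B : VecField P j V} (hA : IsAxial A) (hB : IsAxial B) : IsAxial (A - B) := by
  intro y r hr
  have h : stairSum (A - B) (emb y) (Site.blockSite y r) + stairSum B (emb y) (Site.blockSite y r)
      = stairSum A (emb y) (Site.blockSite y r) := by rw [← stairSum_add, sub_add_cancel]
  rw [hA y r hr, hB y r hr, add_zero] at h
  exact h

omit [Module ℝ V] in
/-- The contour functional is additive in the field. [cite: BalabanImbrieJaffe1985, (5.1.4) p.314] -/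
theorem contour_add (f g : VecField P j V) : contour (f + g) = contour f + contour g := by
  funext z; simp only [contour, Pi.add_apply, stairSum_add]

/-- The contour functional is homogeneous in the field. [cite: BalabanImbrieJaffe1985, (5.1.4) p.314] -/
theorem contour_smul (a : ℝ) (f : VecField P j V) : contour (a • f) = a • contour f := by
  funext z; simp only [contour, Pi.smul_apply, stairSum_smul]

/-- The bracket of (5.1.12) is additive in the field. [cite: BalabanImbrieJaffe1985, (5.1.12) p.315] -/
theorem fluct_add (f g : VecField P j V) : fluct (f + g) = fluct f + fluct g := by
  funext z; simp only [fluct, blockMean, Pi.add_apply, contour_add, siteAvg_add]; abel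

/-- The bracket of (5.1.12) is homogeneous in the field. [cite: BalabanImbrieJaffe1985, (5.1.12) p.315] -/
theorem fluct_smul (a : ℝ) (f : VecField P j V) : fluct (a • f) = a • fluct f := by
  funext z; simp only [fluct, blockMean, Pi.smul_apply, contour_smul, siteAvg_smul, smul_sub]

/-- `λ(A)` IS LINEAR IN `A` (p. 315: *"We now notice that λ = λ(A) is a linear function of A"*): additivity.
[cite: BalabanImbrieJaffe1985, (5.1.14) p.315] -/
theorem lamOf_add (c : ℝ) : ∀ (k : ℕ) (A B : VecField P 0 V), lamOf c k (A + B) = lamOf c k A + lamOf c k B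
  | 0, _, _ => by simp [lamOf]
  | k + 1, A, B => by
    rw [lamOf_succ, lamOf_succ, lamOf_succ, lamOf_add c k, bondAvgIter_add, fluct_add, pull_add, smul_add]
    abel

/-- `λ(A)` is linear in `A`: homogeneity. [cite: BalabanImbrieJaffe1985, (5.1.14) p.315] -/
theorem lamOf_smul (c : ℝ) : ∀ (k : ℕ) (a : ℝ) (A : VecField P 0 V), lamOf c k (a • A) = a • lamOf c k A
  | 0, _, _ => by simp [lamOf]
  | k + 1, a, A => by
    rw [lamOf_succ, lamOf_succ, lamOf_smul c k, bondAvgIter_smul, fluct_smul, pull_smul, smul_sub, smul_comm a]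

/-- `λ(A)` is linear in `A`: `λ(A − A′) = λ(A) − λ(A′)` (p. 315: *"Thus we can write λ(A, x) = λ(H_kB, x) − λ(A − H_kB, x)"*
[sign slip in print: `+ λ(A − H_kB, x)`]). [cite: BalabanImbrieJaffe1985, (5.1.14) p.315] -/
theorem lamOf_sub (c : ℝ) (k : ℕ) (A B : VecField P 0 V) : lamOf c k (A - B) = lamOf c k A - lamOf c k B := by
  rw [sub_eq_add_neg, lamOf_add, ← neg_one_smul ℝ B, lamOf_smul, neg_one_smul, ← sub_eq_add_neg]

/-- `λ(0) = 0`. [cite: BalabanImbrieJaffe1985, (5.1.14) p.315] -/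
theorem lamOf_zero (c : ℝ) (k : ℕ) : lamOf c k (0 : VecField P 0 V) = 0 := by
  have h := lamOf_smul (P := P) (V := V) c k 0 0
  rwa [zero_smul, zero_smul] at h

end Linearity

/-! ## §2  (5.1.10), (5.1.11), (5.1.12): what the axial gauge conditions `δ_{Ax}(Q_j(A + ∂λ))` entail -/

section LinearSystem

variable {P : Params} {j : ℕ} {V : Type*} [AddCommGroup V] [Module ℝ V]

/-- `Q_j(A + ∂λ) = Q_jA + ∂(Q′_jλ)` with the coarse lattice factor `c/L^j` ([Balaban1984PropagatorsI] (1.20), the input of the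
first display of p. 315). [cite: BalabanImbrieJaffe1985, (5.1.10) p.315] -/
theorem bondAvgIter_add_grad (hj : j ≤ P.m + P.K) (c : ℝ) (A : VecField P 0 V) (lam : SiteField P 0 V) :
    bondAvgIter j (A + grad c lam) = bondAvgIter j A + grad (c / (P.L : ℝ) ^ j) (siteAvgIter j lam) := by
  rw [bondAvgIter_add, bondAvgIter_grad j hj c lam]

/-- The first display of p. 315 [PDF 17], verbatim: *"The axial gauge fixing conditions in (5.1.9) entails (Q_jA)(Γ_{z,z′}) =
−(L^jη)^{−1}[(Q′_jλ)(z′) − (Q′_jλ)(z)], where z and z′ are endpoints of a bond in B(x_{j+1}) which lies on an axial gauge fixing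
contour."* — bond form: on every bond `b = ⟨z, z′⟩` where `Q_j(A + ∂λ)` vanishes, `(Q_jA)(b) = −(c/L^j)[(Q′_jλ)(z′) − (Q′_jλ)(z)]`
(`z′ = b₊`, `z = b₋`; standing range). [cite: BalabanImbrieJaffe1985, (5.1.10) p.315] -/
theorem eq5110_bond (hj : j ≤ P.m + P.K) (c : ℝ) {A : VecField P 0 V} {lam : SiteField P 0 V} (b : PBond P j)
    (hb : bondAvgIter j (A + grad c lam) b = 0) :
    bondAvgIter j A b = -((c / (P.L : ℝ) ^ j) • (siteAvgIter j lam b.tgt - siteAvgIter j lam b.src)) := by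
  rw [bondAvgIter_add_grad hj, Pi.add_apply] at hb
  have h := eq_neg_of_add_eq_zero_left hb
  simpa only [grad] using h

/-- **(5.1.10)** p. 315 [PDF 17], verbatim: *"The axial gauge fixing conditions in (5.1.9) entails (Q_jA)(Γ_{z,z′}) =
−(L^jη)^{−1}[(Q′_jλ)(z′) − (Q′_jλ)(z)], where z and z′ are endpoints of a bond in B(x_{j+1}) which lies on an axial gauge fixing
contour. Since every point in B(x_{j+1}) lies on some such contour, we can sum these identities to show that for all x′ ∈ B(x_{j+1}),
(Q_jA)(Γ_{x_{j+1},x′}) = −(L^jη)^{−1}[(Q′_jλ)(x′) − (Q′_jλ)(x_{j+1})]. (5.1.10)"* — typed reading: the axial gauge `IsAxial` of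
`Q_j(A + ∂λ)` at level `j` (one factor of `δ_{k,Ax}(A + ∂λ)`), `x_{j+1} = y ∈ T^{(j+1)}` read in `T^{(j)}` as `emb y`, `x′ =
blockSite y r ∈ B(y)`, the printed `(L^jη)^{−1}` = the coarse factor `c/L^j` (`c = η⁻¹`); the summation along the contour is the
telescoping `stairSum_grad`; standing range. [cite: BalabanImbrieJaffe1985, (5.1.10) p.315] -/
theorem eq5110 (hj : j + 1 ≤ P.m + P.K) (c : ℝ) {A : VecField P 0 V} {lam : SiteField P 0 V}
    (hax : IsAxial (bondAvgIter j (A + grad c lam))) (y : Site P (j + 1)) (r : Fin P.d → Fin P.L) :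
    stairSum (bondAvgIter j A) (emb y) (Site.blockSite y r)
      = -((c / (P.L : ℝ) ^ j) • (siteAvgIter j lam (Site.blockSite y r) - siteAvgIter j lam (emb y))) := by
  by_cases hr : Site.blockSite y r = emb y
  · rw [hr, stairSum_self, sub_self, smul_zero, neg_zero]
  · have h := hax y r hr
    rw [bondAvgIter_add_grad (by omega) c A lam, stairSum_add, stairSum_grad] at h
    exact eq_neg_of_add_eq_zero_left h

/-- The scalar bookkeeping `(L^j/c)·(c/L^j) = 1` behind "multiply (5.1.10) by L^jη". [cite: BalabanImbrieJaffe1985, (5.1.11) p.315] -/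
private theorem weight_mul_inv {c : ℝ} (hc : c ≠ 0) (j : ℕ) : ((P.L : ℝ) ^ j / c) * (c / (P.L : ℝ) ^ j) = 1 := by
  have hL : ((P.L : ℝ) ^ j) ≠ 0 := pow_ne_zero _ (Nat.cast_ne_zero.mpr P.L_pos.ne')
  field_simp

/-- The weights cancel against the coarse lattice factor: `∂^{(c/L^j)}((L^j/c)·F) = ∂^{(1)}F`. [cite: BalabanImbrieJaffe1985, (5.1.13) p.315] -/
theorem grad_weight_cancel {c : ℝ} (hc : c ≠ 0) {j : ℕ} (F : SiteField P j V) :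
    grad (c / (P.L : ℝ) ^ j) (((P.L : ℝ) ^ j / c) • F) = grad 1 F := by
  rw [grad_smul, ← grad_mul, weight_mul_inv hc]

/-- **(5.1.11)** p. 315 [PDF 17], verbatim: *"Summing over x′ ∈ B(x_{j+1}) yields (Q′_jλ)(x_{j+1}) = (Q′_{j+1}λ)(x_{j+1}) +
L^jηQ′(Q_jA)(Γ_{x_{j+1},·}). (5.1.11) We use the fact that (Q′_jλ)(x_{j+1}) is constant in this sum, and the final Q′ acts on '·'."*
— typed reading as in `eq5110`, `Q′(Q_jA)(Γ_{x_{j+1},·}) = blockMean (Q_jA) x_{j+1}`, `L^jη = L^j/c`, `c ≠ 0`; standing range.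
[cite: BalabanImbrieJaffe1985, (5.1.11) p.315] -/
theorem eq5111 (hj : j + 1 ≤ P.m + P.K) {c : ℝ} (hc : c ≠ 0) {A : VecField P 0 V} {lam : SiteField P 0 V}
    (hax : IsAxial (bondAvgIter j (A + grad c lam))) (y : Site P (j + 1)) :
    siteAvgIter j lam (emb y) = siteAvgIter (j + 1) lam y + ((P.L : ℝ) ^ j / c) • blockMean (bondAvgIter j A) y := by
  set g := siteAvgIter j lam with hg
  -- the block mean of (5.1.10): `Q′((Q_jA)(Γ_{y,·}))(y) = −(c/L^j)·((Q′g)(y) − g(emb y))`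
  have hmean : blockMean (bondAvgIter j A) y = -((c / (P.L : ℝ) ^ j) • (siteAvg g y - g (emb y))) := by
    have h1 : blockMean (bondAvgIter j A) y
        = siteAvg (-((c / (P.L : ℝ) ^ j) • (g - fun _ => g (emb y)))) y := by
      unfold blockMean
      refine siteAvg_congr_block y fun r => ?_
      simp only [contour, Site.blockOf_blockSite hj, Pi.neg_apply, Pi.smul_apply, Pi.sub_apply]
      exact eq5110 hj c hax y r
    rw [h1, ← neg_one_smul ℝ ((c / (P.L : ℝ) ^ j) • (g - fun _ => g (emb y))), siteAvg_smul, siteAvg_smul, siteAvg_sub,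
      neg_one_smul, Pi.neg_apply, Pi.smul_apply, Pi.sub_apply, siteAvg_const]
  rw [hmean, smul_neg, smul_smul, weight_mul_inv hc, one_smul, siteAvgIter_succ, ← hg]
  abel

/-- **(5.1.12)** p. 315 [PDF 17], verbatim: *"Substituting (5.1.11) in (5.1.10) with x′ = x_j then gives (Q′_jλ)(x_j) =
(Q′_{j+1}λ)(x_{j+1}) − L^jη[(Q_jA)(Γ_{x_{j+1},x_j}) − Q′(Q_jA)(Γ_{x_{j+1},·})]. (5.1.12) The identities (5.1.12) hold for
j = 0, 1, …, k − 1."* — typed reading: for every `z = x_j ∈ T^{(j)}` with `x_{j+1} = blockOf z`, the bracket being `fluct (Q_jA) z`;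
hypotheses as in `eq5111`. [cite: BalabanImbrieJaffe1985, (5.1.12) p.315] -/
theorem eq5112 (hj : j + 1 ≤ P.m + P.K) {c : ℝ} (hc : c ≠ 0) {A : VecField P 0 V} {lam : SiteField P 0 V}
    (hax : IsAxial (bondAvgIter j (A + grad c lam))) (z : Site P j) :
    siteAvgIter j lam z = siteAvgIter (j + 1) lam (blockOf z) - ((P.L : ℝ) ^ j / c) • fluct (bondAvgIter j A) z := by
  obtain ⟨r, hr⟩ := exists_blockSite_eq hj z
  -- (5.1.10) with x′ = x_j, multiplied by L^jη
  have h10 := eq5110 hj c hax (blockOf z) r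
  rw [hr] at h10
  have h10' : ((P.L : ℝ) ^ j / c) • stairSum (bondAvgIter j A) (emb (blockOf z)) z
      = -(siteAvgIter j lam z - siteAvgIter j lam (emb (blockOf z))) := by
    rw [h10, smul_neg, smul_smul, weight_mul_inv hc, one_smul]
  -- (5.1.11) at x_{j+1} = blockOf z
  have h11 := eq5111 hj hc hax (blockOf z)
  have hfl : fluct (bondAvgIter j A) z = stairSum (bondAvgIter j A) (emb (blockOf z)) z - blockMean (bondAvgIter j A) (blockOf z) :=
    rfl
  rw [hfl, smul_sub, h10', h11]
  abel

end LinearSystem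

/-! ## §3  (5.1.13): the linear system of (5.1.9) solved — uniqueness (the printed telescoping), existence, the `∃!` statement -/

section Solution

variable {P : Params} {V : Type*} [AddCommGroup V] [Module ℝ V]

/-- THE TELESCOPING of p. 315, verbatim: *"Furthermore, summing (5.1.12) from j = 0 to j = k − 1, the factors (Q′_jλ)(x_j) cancel
except for j = 0 and j = k. Thus λ(x) = (Q′_kλ)(x_k) − Σ_{j=0}^{k−1} L^jη[(Q_jA)(Γ_{x_{j+1},x_j}) − Q′(Q_jA)(Γ_{x_{j+1},·})]."* —
for every gauge function `λ` with `δ_{k,Ax}(A + ∂λ)`: `λ = (Q′_kλ)(x_k) + λ_k(A)` as site functions (`pull k` reads `Q′_kλ` at `x_k`);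
standing range `k ≤ m + K`, `c ≠ 0`. [cite: BalabanImbrieJaffe1985, (5.1.13) p.315] -/
theorem eq_pull_add_lamOf {c : ℝ} (hc : c ≠ 0) :
    ∀ (k : ℕ), k ≤ P.m + P.K → ∀ (A : VecField P 0 V) (lam : SiteField P 0 V),
      deltaAx k (A + grad c lam) → lam = pull k (siteAvgIter k lam) + lamOf c k A
  | 0, _, A, lam, _ => by
    show lam = siteAvgIter 0 lam + 0
    rw [siteAvgIter_zero, add_zero]
  | k + 1, hk, A, lam, hax => by
    obtain ⟨hax', haxk⟩ := (deltaAx_succ k _).1 hax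
    have ih := eq_pull_add_lamOf hc k (by omega) A lam hax'
    -- (5.1.12) at level k, as an identity of site functions on T^{(k)}
    have h12 : siteAvgIter k lam
        = (fun z => siteAvgIter (k + 1) lam (blockOf z)) - ((P.L : ℝ) ^ k / c) • fluct (bondAvgIter k A) := by
      funext z
      rw [Pi.sub_apply, Pi.smul_apply]
      exact eq5112 hk hc haxk z
    rw [h12, pull_sub, pull_smul, ← pull_succ] at ih
    calc lam = pull (k + 1) (siteAvgIter (k + 1) lam) - ((P.L : ℝ) ^ k / c) • pull k (fluct (bondAvgIter k A))
          + lamOf c k A := ih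
      _ = pull (k + 1) (siteAvgIter (k + 1) lam) + lamOf c (k + 1) A := by rw [lamOf_succ]; abel

/-- **(5.1.13)** p. 315 [PDF 17] — UNIQUENESS of the solution of the linear system of (5.1.9), verbatim: *"Using the δ function for
Q′_kλ, and η = L^{−k} gives λ(x) = λ(A, x) = −Σ_{j=0}^{k−1} L^{j−k}[(Q_jA)(Γ_{x_{j+1},x_j}) − Q′(Q_jA)(Γ_{x_{j+1},·})]. (5.1.13)"* —
every `λ` with `Q′_kλ = 0` (`δ(Q′_kλ)`) and `δ_{k,Ax}(A + ∂λ)` IS `lamOf c k A`; standing range, `c ≠ 0`.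
[cite: BalabanImbrieJaffe1985, (5.1.13) p.315] -/
theorem eq5113 {k : ℕ} (hk : k ≤ P.m + P.K) {c : ℝ} (hc : c ≠ 0) {A : VecField P 0 V} {lam : SiteField P 0 V}
    (hnull : siteAvgIter k lam = 0) (hax : deltaAx k (A + grad c lam)) : lam = lamOf c k A := by
  have h := eq_pull_add_lamOf hc k hk A lam hax
  rwa [hnull, pull_zero, zero_add] at h

/-- The gradient of a function of `x_{j+1}` is invisible to the level-`j` axial gauge: `Q_j∂(h(x_k))` has zero sum along every
contour `Γ_{y,x′}`, `x′ ∈ B(y)`, for `j < k` (it is the coarse gradient of a block-constant function).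
[cite: BalabanImbrieJaffe1985, (5.1.10) p.315] -/
theorem isAxial_bondAvgIter_grad_pull {j k : ℕ} (hjk : j < k) (hk : k ≤ P.m + P.K) (c : ℝ) (h : SiteField P k V) :
    IsAxial (bondAvgIter j (grad c (pull k h))) := by
  obtain ⟨h', e⟩ := pull_factor j k hjk h
  rw [e, pull_succ, bondAvgIter_grad j (by omega), siteAvgIter_pull j (by omega)]
  intro y r _
  rw [stairSum_grad, Site.blockOf_blockSite (by omega), Site.blockOf_emb (by omega), sub_self, smul_zero]

/-- SUBTRACTING THE GRADIENT OF THE BRACKET FIXES THE AXIAL GAUGE at one level: for every bond field `X` of `T^{(j)}`,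
`X − ∂^{(1)}(fluct X)` satisfies `(·)(Γ_{y,x′}) = 0` for all `x′ ∈ B(y)` (the mechanism by which (5.1.13) solves the `j`-th
condition of `δ_{k,Ax}(A + ∂λ)`); standing range. [cite: BalabanImbrieJaffe1985, (5.1.10) p.315] -/
theorem isAxial_sub_grad_fluct {j : ℕ} (hj : j + 1 ≤ P.m + P.K) (X : VecField P j V) : IsAxial (X - grad 1 (fluct X)) := by
  intro y r _
  have hsplit : stairSum (X - grad 1 (fluct X)) (emb y) (Site.blockSite y r)
      = stairSum X (emb y) (Site.blockSite y r) - stairSum (grad 1 (fluct X)) (emb y) (Site.blockSite y r) := by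
    have h := stairSum_add (X - grad 1 (fluct X)) (grad 1 (fluct X)) (emb y) (Site.blockSite y r)
    rw [sub_add_cancel] at h
    rw [h, add_sub_cancel_right]
  rw [hsplit, stairSum_grad, one_smul]
  simp only [fluct, contour, Site.blockOf_blockSite hj, Site.blockOf_emb hj, stairSum_self, zero_sub, sub_neg_eq_add,
    sub_add_cancel, sub_self]

/-- EXISTENCE, first constraint: `λ(A)` satisfies `δ(Q′_kλ)`, i.e. `Q′_k(λ_k(A)) = 0` (standing range, `c ≠ 0` not needed).
[cite: BalabanImbrieJaffe1985, (5.1.13) p.315] -/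
theorem siteAvgIter_lamOf (c : ℝ) : ∀ (k : ℕ), k ≤ P.m + P.K → ∀ A : VecField P 0 V, siteAvgIter k (lamOf c k A) = 0
  | 0, _, _ => rfl
  | k + 1, hk, A => by
    rw [siteAvgIter_succ, lamOf_succ, siteAvgIter_sub, siteAvgIter_smul, siteAvgIter_lamOf c k (by omega),
      siteAvgIter_pull k (by omega), zero_sub, ← smul_neg, siteAvg_smul, ← neg_one_smul ℝ (fluct (bondAvgIter k A)),
      siteAvg_smul, siteAvg_fluct hk, smul_zero, smul_zero]

/-- EXISTENCE, second constraint: `λ(A)` satisfies `δ_{k,Ax}(A + ∂λ)`, i.e. `Q_j(A + ∂λ_k(A))` is in the axial gauge for every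
`j < k` (standing range, `c ≠ 0`). [cite: BalabanImbrieJaffe1985, (5.1.13) p.315] -/
theorem deltaAx_lamOf {c : ℝ} (hc : c ≠ 0) : ∀ (k : ℕ), k ≤ P.m + P.K → ∀ A : VecField P 0 V,
    deltaAx k (A + grad c (lamOf c k A))
  | 0, _, A => deltaAx_zero _
  | k + 1, hk, A => by
    have hsplit : A + grad c (lamOf c (k + 1) A)
        = (A + grad c (lamOf c k A)) - ((P.L : ℝ) ^ k / c) • grad c (pull k (fluct (bondAvgIter k A))) := by
      rw [lamOf_succ, grad_sub, grad_smul]; abel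
    rw [deltaAx_succ]
    refine ⟨fun j hj => ?_, ?_⟩
    · -- levels j < k: the induction hypothesis plus `isAxial_bondAvgIter_grad_pull`
      rw [hsplit, bondAvgIter_sub, bondAvgIter_smul]
      exact isAxial_sub (deltaAx_lamOf hc k (by omega) A j hj)
        (isAxial_smul _ (isAxial_bondAvgIter_grad_pull hj (by omega) c _))
    · -- level k: `Q_k(A + ∂λ_{k+1}(A)) = Q_kA − ∂^{(1)} fluct(Q_kA)`
      have hQ : bondAvgIter k (A + grad c (lamOf c (k + 1) A))
          = bondAvgIter k A - grad 1 (fluct (bondAvgIter k A)) := by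
        rw [bondAvgIter_add_grad (by omega), lamOf_succ, siteAvgIter_sub, siteAvgIter_smul,
          siteAvgIter_lamOf c k (by omega), siteAvgIter_pull k (by omega), zero_sub, grad_neg, grad_weight_cancel hc,
          ← sub_eq_add_neg]
      rw [hQ]
      exact isAxial_sub_grad_fluct hk _

/-- **The linear system of (5.1.9) has exactly one solution**, p. 314 [PDF 16], verbatim: *"In order to evaluate (5.1.9), we
solve the system of linear equations for λ which result from the delta functions δ(Q′_kλ) and δ_{k,Ax}(A + ∂λ). Using this value
of λ = λ(A), we have H_{k,Ax}B = Z_k(B)^{−1}∫dA δ(Q_kA − B)𝒢(∂*A)exp(−½‖∂A‖²)(A + ∂λ(A))."* — for every η-lattice bond field `A`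
there is exactly one gauge function `λ` with `Q′_kλ = 0` and `δ_{k,Ax}(A + ∂λ)`, namely `λ(A)` of (5.1.13) (standing range
`k ≤ m + K`, lattice factor `c ≠ 0`). [cite: BalabanImbrieJaffe1985, (5.1.9) p.314] -/
theorem existsUnique_gaugeFn {k : ℕ} (hk : k ≤ P.m + P.K) {c : ℝ} (hc : c ≠ 0) (A : VecField P 0 V) :
    ∃! lam : SiteField P 0 V, siteAvgIter k lam = 0 ∧ deltaAx k (A + grad c lam) :=
  ⟨lamOf c k A, ⟨siteAvgIter_lamOf c k hk A, deltaAx_lamOf hc k hk A⟩, fun _ h => eq5113 hk hc h.1 h.2⟩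

/-- After the solution: `Q_k(A + ∂λ(A)) = Q_kA` — the block averages of order `k` are untouched (*"using Q_kA → Q_kA + Q_k∂λ =
Q_kA + ∂Q′_kλ = Q_kA, on account of the δ function"*, p. 314, the step before (5.1.8)); standing range.
[cite: BalabanImbrieJaffe1985, (5.1.8) p.314] -/
theorem bondAvgIter_add_grad_lamOf {k : ℕ} (hk : k ≤ P.m + P.K) (c : ℝ) (A : VecField P 0 V) :
    bondAvgIter k (A + grad c (lamOf c k A)) = bondAvgIter k A := by
  rw [bondAvgIter_add_grad hk, siteAvgIter_lamOf c k hk A]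
  funext b
  simp [grad]

end Solution

/-! ## §4  (5.1.14)–(5.1.15): `H_{k,Ax}B = H_kB + ∂λ(H_kB)` for the mean of ANY field law — the linearity argument of p. 315 -/

section Mean

open _root_.MeasureTheory

variable {P : Params}

/-- *"λ = λ(A) is a linear function of A … comes outside the A integral"* (p. 315): the map `A ↦ ∂λ(A)` is `ℝ`-linear on the
(finite-dimensional) real η-lattice bond fields, hence commutes with the Bochner integral of any integrable field-valued `φ`.
[cite: BalabanImbrieJaffe1985, (5.1.14) p.315] -/
theorem integral_grad_lamOf (c : ℝ) (k : ℕ) {X : Type*} [MeasurableSpace X] (μ : Measure X) {φ : X → VecField P 0 ℝ}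
    (hφ : Integrable φ μ) : ∫ x, grad c (lamOf c k (φ x)) ∂μ = grad c (lamOf c k (∫ x, φ x ∂μ)) := by
  let Lg : VecField P 0 ℝ →ₗ[ℝ] VecField P 0 ℝ :=
    { toFun := fun A => grad c (lamOf c k A)
      map_add' := fun A B => by simp only [lamOf_add, grad_add]
      map_smul' := fun a A => by simp only [lamOf_smul, grad_smul, RingHom.id_apply] }
  have h := ContinuousLinearMap.integral_comp_comm (LinearMap.toContinuousLinearMap Lg) hφ
  simp only [LinearMap.coe_toContinuousLinearMap', Lg, LinearMap.coe_mk, AddHom.coe_mk] at h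
  exact h

/-- The same for `A ↦ A + ∂λ(A)` (the integrand of the last display of p. 314): `∫(φ + ∂λ(φ))dμ = ∫φ dμ + ∂λ(∫φ dμ)`.
[cite: BalabanImbrieJaffe1985, (5.1.14) p.315] -/
theorem integral_add_grad_lamOf (c : ℝ) (k : ℕ) {X : Type*} [MeasurableSpace X] (μ : Measure X) {φ : X → VecField P 0 ℝ}
    (hφ : Integrable φ μ) : ∫ x, (φ x + grad c (lamOf c k (φ x))) ∂μ = (∫ x, φ x ∂μ) + grad c (lamOf c k (∫ x, φ x ∂μ)) := by
  let Ls : VecField P 0 ℝ →ₗ[ℝ] VecField P 0 ℝ :=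
    { toFun := fun A => A + grad c (lamOf c k A)
      map_add' := fun A B => by rw [lamOf_add, grad_add]; abel
      map_smul' := fun a A => by rw [lamOf_smul, grad_smul, RingHom.id_apply, smul_add] }
  have h := ContinuousLinearMap.integral_comp_comm (LinearMap.toContinuousLinearMap Ls) hφ
  simp only [LinearMap.coe_toContinuousLinearMap', Ls, LinearMap.coe_mk, AddHom.coe_mk] at h
  exact h

/-- **(5.1.15) / the vanishing term of (5.1.14)**, p. 315 [PDF 17], verbatim: *"Since H_kB minimizes the quadratic form ‖∂A‖² subject
to the restrictions imposed by δ(Q_kA − B) and 𝒢, the term in (5.1.14) involving ∂λ(A − H_kB) is linear in A − H_kB and hence its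
integral vanishes."* — typed reading: for any probability law `μ` of the real η-lattice bond fields with mean `H` (= `H_kB`),
`∫∂λ(A − H)dμ(A) = 0`. [cite: BalabanImbrieJaffe1985, (5.1.14) p.315] -/
theorem eq5114_vanish (c : ℝ) (k : ℕ) (μ : Measure (VecField P 0 ℝ)) [IsProbabilityMeasure μ]
    (hμ : Integrable (fun A : VecField P 0 ℝ => A) μ) {H : VecField P 0 ℝ} (hH : ∫ A, A ∂μ = H) :
    ∫ A, grad c (lamOf c k (A - H)) ∂μ = 0 := by
  have hint : Integrable (fun A : VecField P 0 ℝ => A - H) μ := hμ.sub (integrable_const H)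
  rw [integral_grad_lamOf c k μ hint, integral_sub hμ (integrable_const H), integral_const, hH]
  simp [lamOf_zero, grad_zero]

/-- **(5.1.14)** p. 315 [PDF 17], verbatim: *"We now notice that λ = λ(A) is a linear function of A. Thus we can write λ(A, x) =
λ(H_kB, x) − λ(A − H_kB, x)* [sic: linearity gives `+`; HOME/GAPS.md G-C1-01] *. The term λ(H_kB, x) is independent of A and comes
outside the A integral. Thus H_{k,Ax}B = H_kB + ∂λ(H_kB) + Z_k(B)^{−1}∫dAδ(Q_kA − B)𝒢(∂*A)exp(−½‖∂A‖²)∂λ(A − H_kB). (5.1.14)"* —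
typed reading: the normalized `A`-integral `Z_k(B)^{−1}∫dA δ(Q_kA − B)𝒢(∂*A)exp(−½‖∂A‖²)(·)` is the expectation under a probability law
`μ` of the real η-lattice bond fields whose mean is `H = H_kB` (the Landau-gauge minimizer, (5.1.7)); then
`∫(A + ∂λ(A))dμ = H + ∂λ(H) + ∫∂λ(A − H)dμ`.  That the left side IS the axial-gauge mean `H_{k,Ax}B` of (5.1.5) is the Faddeev–Popov
manipulation (5.1.5)–(5.1.9), the instance's. [cite: BalabanImbrieJaffe1985, (5.1.14) p.315] -/
theorem eq5114 (c : ℝ) (k : ℕ) (μ : Measure (VecField P 0 ℝ)) [IsProbabilityMeasure μ]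
    (hμ : Integrable (fun A : VecField P 0 ℝ => A) μ) {H : VecField P 0 ℝ} (hH : ∫ A, A ∂μ = H) :
    ∫ A, (A + grad c (lamOf c k A)) ∂μ = H + grad c (lamOf c k H) + ∫ A, grad c (lamOf c k (A - H)) ∂μ := by
  rw [eq5114_vanish c k μ hμ hH, add_zero, integral_add_grad_lamOf c k μ hμ, hH]

/-- **Proposition 5.1.1 / (5.1.1) in mean form**, p. 315 [PDF 17], verbatim: *"Thus H_{k,Ax}B = H_kB + ∂λ(H_kB), and the proof of
Proposition 5.1.1 is complete."* — for EVERY law `μ` of the real η-lattice bond fields with integrable identity (no normalization or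
symmetry is needed: `A ↦ A + ∂λ(A)` is linear and commutes with the Bochner integral): `∫(A + ∂λ(A))dμ − H_kB = ∂λ(H_kB)`, where
`H_kB := ∫A dμ` and `λ = λ(H_kB)` is (5.1.4) = (5.1.13) at `A = H_kB`; the left integral is the printed `H_{k,Ax}B` by (5.1.5)–(5.1.9)
(the instance's). [cite: BalabanImbrieJaffe1985, Prop. 5.1.1 (5.1.15) p.315] -/
theorem prop511_mean (c : ℝ) (k : ℕ) (μ : Measure (VecField P 0 ℝ)) (hμ : Integrable (fun A : VecField P 0 ℝ => A) μ) :
    (∫ A, (A + grad c (lamOf c k A)) ∂μ) - ∫ A, A ∂μ = grad c (lamOf c k (∫ A, A ∂μ)) := by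
  rw [integral_add_grad_lamOf c k μ hμ, add_sub_cancel_left]

end Mean

end Literature.MathematicalPhysics.QuantumFieldTheory.BalabanImbrieJaffe1984to88.BIJ85Eq5113Proof
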